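import Summits.HodgeConjecture.CorCM.HypDel.ExtAmbientReceptacleQArchA
import Literature.AlgebraicGeometry.ShimuraVarieties.UnitaryAuxiliarySiegelSliceLift
import Literature.AlgebraicGeometry.ShimuraVarieties.UnitaryAuxiliarySiegelPointWellDefined
import HarnessLib

/-!
# T3 v4.1 — `stub_S2pair : QArch.S2Pair` CLOSED from the (σ5) named fact `siegel_borel_extension` and the period chart of `J_{β,Φ}`
# (γ-assembly of S2pair = α + β + Borel; crux `HDel`, stmt-HodgeConjecture-24835)

Cell `hodgecm-mathlib`, crux `HDel` (I-1′ `canonicalModel_exists_ext_printed`), T3 workfile v4.1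
`Cruxes/HDel/Lines/F1ExtHodgeType.lean` (B-plan2 g5, 2026-08-28T15:25:46Z; line of record 15:43:08Z (a)), registered stub
`stub_S2pair : QArch.S2Pair` — existence of the MORPHISM of complex varieties `ι′ : Sh_{K_V}(U(H)) × Cl(L_V) ⟶ Sh_{K_δ(N)}(GSp_δ)` with the point
formula `PointFormulaN` ([Deligne 1979] Prop. 2.3.10: the symplectic embedding of the auxiliary Hodge-type datum; [Milne ISV] Thm. 5.16 «obvious
from (3.14)»).  THEOREMS ONLY; proof lane, `--supports stmt-HodgeConjecture-24835 --as helper`.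

ASSEMBLY.  α = ★ `UnitaryCanonicalModel.Aux.exists_siegelPointMap` (B-p09; the Siegel point `[J_{β,Φ}(x), ũ_β(a,t)·K_δ(N)]` depends only
on `([x, aK_V], [t])` at any level containing `ũ(K_V × L_V)`) · β = ★ `hasHolomorphicSiegelLift_auxSlice`
(A-p08; every summand's point map has holomorphic Siegel lifts, given the ball period chart of `J_{β,Φ}`) · (σ5) = ★ `siegel_borel_extension.exists_sigmaDesc` (B-typ04; Borel: a point map with holomorphic Siegel
lifts is a morphism, summand by summand over `∐_{Cl(L_V)} Sc.Mc_{K_V}`).  HYPOTHESES of `stub_S2pair_holds`: `hB : siegel_borel_extension`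
(NAMED FACT, fan-B row #61; the workfile's fact-stub `stub_borel`) and `hPC` = the PERIOD CHART of `J_{β,Φ}` in the EXACT text of B-p05's
`S2Imm_of_periodChart` (TARGET 1 `UnitaryAuxiliaryPeriodMap`, a THEOREM when it lands; one `stub_periodChart` serves `stub_S2imm` and
`stub_S2pair`).  So: `stub_S2pair := stub_S2pair_holds stub_borel stub_periodChart`.

HC_CM is proved only modulo the 7 printed citations until rung 0 closes; nothing here discharges `HDel` by itself.

## References
* [Deligne1979ShimuraVarieties] P. Deligne, *Variétés de Shimura* (1979), Prop. 2.3.10.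
* [Milne2005ShimuraVarieties] J. S. Milne, *Introduction to Shimura varieties* (2005), Thm. 5.16, Thm. 3.14, Lemma 5.13.
* [Deligne1971TravauxShimura] P. Deligne, *Travaux de Shimura* (1971), 1.14, Prop. 1.15.
-/

set_option autoImplicit false

-- mandated namespace `Summit.HodgeConjecture.HodgeConjecture.Theorems` trips `linter.dupNamespace` (single-problem summit; the lakefile turns
-- the linter off tree-wide as a weak option), restated here so stand-alone elaboration is warning-free.
set_option linter.dupNamespace false

noncomputable section

open Function MulAction Topology NumberField IsDedekindDomain CategoryTheory CategoryTheory.Limits Matrix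
  AlgebraicGeometry
open scoped Matrix ComplexOrder
open Literature.AlgebraicGeometry Literature.AlgebraicGeometry.Motives
open Literature.NumberTheory.Automorphic Literature.NumberTheory.Automorphic.UnitaryGroup
open Literature.NumberTheory.Automorphic.ShimuraDissection
open Literature.NumberTheory.Automorphic.Liu2021.AppendixC (C5.OpenCompactSubgroup C5.SmallLevel)
open Literature.Geometry.ComplexHyperbolic Literature.Geometry.ComplexHyperbolic.BallModel
open Literature.AlgebraicGeometry.ModuliOfAbelianVarieties
open Literature.AlgebraicGeometry.ModuliOfAbelianVarieties.SiegelModuli (C0 jOfSiegel)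
open Literature.NumberTheory.ModularForms.SiegelUpperHalfSpace (coordCLE siegelUpperHalfSpaceCoord)
open Literature.LinearAlgebra.Matrix (symmetricSubmodule)
open Literature.AlgebraicGeometry.ShimuraVarieties Literature.AlgebraicGeometry.ShimuraVarieties.UnitaryCanonicalModel
open Literature.AlgebraicGeometry.ShimuraVarieties.UnitaryCanonicalModel.Aux
open Summit.HodgeConjecture.CorCM.HypDel.ExtReceptacle Summit.HodgeConjecture.CorCM.HypDel.ExtReceptacle.QArch

namespace Summit.HodgeConjecture.HodgeConjecture.Theorems

/-- **`stub_S2pair` of the T3 v4.1 registry (crux `HDel`, stmt-HodgeConjecture-24835) from the (σ5) NAMED FACT `siegel_borel_extension`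
and the PERIOD CHART of `J_{β,Φ}` (B-p05's `UnitaryAuxiliaryPeriodMap` export, hypothesis `hP` until it lands — the EXACT text of
`S2Imm_of_periodChart`'s `hP`, so ONE registered `stub_periodChart` serves both closers)**: α (★ `exists_siegelPointMap`: the Siegel point
map is well defined on `Sh_{K_V} × Cl(L_V)`) + β (★ `hasHolomorphicSiegelLift_auxSlice`: each summand's point map has holomorphic Siegel lifts)
+ ★ `siegel_borel_extension.exists_sigmaDesc` (Borel: it is a morphism, summand by summand) ⇒ the morphism
`ι′ : (complexSystemExt M Sc L_V).obj K_V ⟶ Sg.Mc_{K_δ(N)}` with the point formula `PointFormulaN`.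
[cite: Deligne1979ShimuraVarieties, Prop. 2.3.10] [cite: Milne2005ShimuraVarieties, Thm. 5.16, Thm. 3.14] [cite: Deligne1971TravauxShimura, 1.14, 1.15] -/
theorem stub_S2pair_holds (hB : siegel_borel_extension)
    (hP : ∀ (L : Type) [Field L] [NumberField L] [IsCMField L] (H : Matrix (Fin 3) (Fin 3) L) (τ : L →+* ℂ)
      (T : GL (Fin 3) ℂ), formCongr (starRingEnd ℂ) T (H.map τ) = BallModel.J →
      (∀ τ' : L →+* ℂ, InfinitePlace.mk τ' ≠ InfinitePlace.mk τ → (H.map τ').PosDef) →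
      ∀ (M : Type) [Field M] [NumberField M] [IsCMField M] (j : L →+* M) (Φ : CMType M), IsExtAdapted τ j Φ →
      ∀ (ξ₀ ξ : M) (g : ℕ) (δ : Fin g → ℕ) (F : SymplecticFrame M j H ξ₀ ξ g δ),
      IsAuxScalars M Φ ξ₀ ξ → 0 < g → IsPolarizationType δ →
      ∀ γ : ↥(gspReal δ), (∀ x : Ball, conjJ (γ : GL (Fin g ⊕ Fin g) ℝ) (auxComplexStructure F τ Φ T x) ∈ C0 δ) →
        ∃ P : (Fin 2 → ℂ) → (Sym2 (Fin g) → ℂ), DifferentiableOn ℂ P BallForms.ballSet ∧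
          (∀ w ∈ BallForms.ballSet, Function.Injective (fderiv ℂ P w)) ∧
          ∀ x : Ball, P x.1 ∈ siegelUpperHalfSpaceCoord g ∧
            conjJ (γ : GL (Fin g ⊕ Fin g) ℝ) (auxComplexStructure F τ Φ T x) =
              jOfSiegel δ (((coordCLE g).symm (P x.1) : symmetricSubmodule (Fin g) ℂ) : Matrix (Fin g) (Fin g) ℂ)) :
    S2Pair := by
  intro L _ _ _ H τ T hT hpos hanis K₀ htf Sc M _ _ _ j Φ hΦ ξ₀ ξ g δ F hsc hg hδ hJ Sg N hN KV LV hprod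
  -- α: the Siegel point map is well defined on `Sh_{K_V} × Cl(L_V)` at level `K_δ(N) ⊇ ũ(K_V × L_V)`
  have hle : KV.1.1.prod LV.1 ≤ ((SiegelLevel.ofNat δ N hN).1 : Subgroup (gspFinAdelic δ)).comap (auxToGspFin F) := by
    intro q hq
    have hq' : q ∈ auxLevel F N := by
      rw [show auxLevel F N = KV.1.1.prod LV.1 from hprod]
      exact hq
    exact (mem_auxLevel_iff F N q).1 hq'
  obtain ⟨φ, hφ⟩ := exists_siegelPointMap M F τ Φ T hT hJ KV.1.1 LV (SiegelLevel.ofNat δ N hN).1 hle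
  -- representatives of the torus classes
  have hsurj : Function.Surjective (classOf M LV) := QuotientGroup.mk'_surjective _
  choose t ht using hsurj
  -- the point maps of the summands and their holomorphic Siegel lifts (β)
  let f : classGroup M LV → ComplexPoints (Sc.Mc.obj KV) → ComplexPoints (Sg.Mc.obj (SiegelLevel.ofNat δ N hN)) :=
    fun p P => (Sg.pts (SiegelLevel.ofNat δ N hN)).symm (φ p (Sc.pts KV P))
  have hf : ∀ p, HasHolomorphicSiegelLift Sc KV Sg (SiegelLevel.ofNat δ N hN) (f p) := fun p =>
    hasHolomorphicSiegelLift_auxSlice Sc KV hpos Φ hΦ (fun ρ => (hsc.2.2 ρ.1 ρ.2).1) (fun ρ => (hsc.2.2 ρ.1 ρ.2).2) hg hδ.1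
      F hJ Sg (SiegelLevel.ofNat δ N hN)
      (fun γ hγ => by
        obtain ⟨P, hd, -, hx⟩ := hP L H τ T hT hpos M j Φ hΦ ξ₀ ξ g δ F hsc hg hδ γ hγ
        exact ⟨P, hd, hx⟩)
      (t p) (f p) fun x a => by
        have h := hφ (t p) x a
        rw [ht p] at h
        change (Sg.pts (SiegelLevel.ofNat δ N hN)).symm (φ p (Sc.pts KV ((Sc.pts KV).symm _))) = _
        rw [Homeomorph.apply_symm_apply, h]
  -- Borel (σ5), summand by summand
  obtain ⟨ι', hι'⟩ := siegel_borel_extension.exists_sigmaDesc M hB hpos hanis htf Sc LV KV hg hδ Sg N hN f hf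
  refine ⟨ι', fun p x a t' ht' => ?_⟩
  subst ht'
  rw [hι']
  change (Sg.pts (SiegelLevel.ofNat δ N hN)).symm (φ _ (Sc.pts KV ((Sc.pts KV).symm _))) = _
  rw [Homeomorph.apply_symm_apply, hφ]

end Summit.HodgeConjecture.HodgeConjecture.Theorems

end
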